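import Summits.BirchSwinnertonDyer.BirchSwinnertonDyer.Theorems.PrintX6AnticyclotomicRankZeroErratumLinks
import HarnessLib

/-!
# The anticyclotomic road in analytic rank ZERO at a Jetchev–Skinner–Wan field (`N⁻ ≠ 1`): the
# (IMC≥∘BDP)ᵍ link `X11b.IMCLowerWaldspurgerOnTreeGoodAt` DISCHARGED from the displayed conclusion of
# Castella–Wan 2024 Thm. 5.3 ∘ Brooks at the trivial character + Castella 2018 Thm. 2.3 (control)
# (cell `bsd-print-x6`, prover p3 «anticyclotomic road», road (I) = PLAN.md v4.2 (R2))

HONEST FRAMING. Cell `bsd-print-x6` (HOME `run/shared/lean/pub/bsd-print-x6/`, D-0131 (2) PRINT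
TIER, leaf `ClassX6 W p ∧ W.analyticRank = 0`; route `PrintX6`, residual crux
`EisensteinHalfFiveLeRest` = item stmt-BirchSwinnertonDyer-21116). THEOREMS ONLY (no definition, no
named fact, no `sorry`); nothing about any curve is asserted; nothing is booked; PARTITION: 0 cells.

Road (I) (INERT PAIR): for `E` of analytic rank `0` in class X6 at `p ≥ 5`, `K` is an imaginary
quadratic field with an even non-empty set `S` of multiplicative primes INERT, every other bad prime
and `p` SPLIT (Jetchev–Skinner–Wan's (H), `N⁻ = ∏S`), so that `E/K` has analytic rank `1` through a
twist with a simple zero; the Heegner point comes from the Shimura curve `X_{N⁺,N⁻}`. The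
main-conjecture input is the named fact
`Literature.NumberTheory.EllipticCurves.shimuraCurve_heegnerPoint_grossZagier_bdpLowerBound_goodSS`
(Cai–Shu–Tian 2014 Thm. 1.5 + Castella–Wan 2024 Thm. 5.3 (integral clause, `N⁻ ≠ 1`) ∘
Jetchev–Skinner–Wan 2017 §5.1.2 [Brooks 2015] at `𝟙`), whose second conjunct has EXACTLY the shape of
the `N⁻ = 1` composite `castellaWan2024_thm53_castella2018_thm32_constantCoeff`'s conclusion. THIS FILE
is fact-free: it takes that conjunct at one point `P ∈ E(K)` as a DISPLAYED HYPOTHESIS `hBDP` (so it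
compiles before the fact lands and serves any future supplier of the same display) and proves

* §1 `le_valuation_constantCoeff_of_bdpDisplay` — the display in valuations: for every generator `𝓖`
  of `ch_Λ(X_ac)` (strict at `vbar`) with `𝓖(0) ≠ 0`,
  `2·(ord_p(1 − a_p + p) − 1 + ord_p log_{ω_E} P_v) ≤ ord_p 𝓖(0)` (the seat's
  `le_valuation_constantCoeff_of_thm53thm32`, letter for letter);
* §2 `X11b.imcLowerWaldspurgerOnTreeGoodAt_of_bdpDisplay_of_thm23` — the on-tree link
  `X11b.IMCLowerWaldspurgerOnTreeGoodAt p κ 𝔭 γ (embAt K p 𝔭) P` from `hBDP` and Castella 2018 Thm. 2.3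
  (`h23`: `K` imaginary quadratic with `p` split, NOTHING assumed at the other primes of `N` — so JSW
  fields qualify), `rank E(K) = 1`, `#Ш(E/K)[p^∞] < ∞`, `P` of infinite order (the seat's
  `X11b.imcLowerWaldspurgerOnTreeGoodAt_of_thm53thm32_of_thm23_clauses`, letter for letter: generator
  from Thm. 2.3 at THE embedding `embAt 𝔭`, the display at the OTHER prime `w`, strict prime `𝔭`, the
  two logarithm valuations agree in rank one).

References: [CastellaWan2023] Thm. 5.3 (MS pp. 23–24); [JetchevSkinnerWan2017] §5.1.2 (arXiv pp. 22–23),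
§7.4.2 (p. 30); [Castella2018] Def. 2.2, Thm. 2.3 (p. 5); [Brooks2015IMRN] Thm. 1.1.
-/

set_option linter.dupNamespace false
set_option autoImplicit false

noncomputable section

open scoped Classical

open WeierstrassCurve NumberField IsDedekindDomain Field Literature.NumberTheory.EllipticCurves
  Literature.NumberTheory.EllipticCurves.ModularForms
  Literature.NumberTheory.EllipticCurves.Rank1Residual
  Literature.NumberTheory.EllipticCurves.Rank1Residual.Typed
  Literature.NumberTheory.EllipticCurves.Castella2018
  Summit.BirchSwinnertonDyer.Rank1Residual
  Summit.BirchSwinnertonDyer.Rank1Residual.Supersingular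

namespace Summit.BirchSwinnertonDyer.BirchSwinnertonDyer.Theorems.AnticyclotomicRankZero

/-! ### §0 A private valuation helper (copy of the seat's, `PrintX6AnticyclotomicCW53Composite.lean`) -/

section Valuation

variable {p : ℕ} [hp : Fact p.Prime]

/-- `ord_p` of the right-hand side of the display: for `e ∈ ℤ_p`, an integer `a`, `L ∈ ℚ_p` and
`m ∈ ℕ`, if `e · ((1 − a p⁻¹ + p⁻¹) · (L/m))² ≠ 0` then its valuation is
`ord_p e + 2·(ord_p(1 − a + p) − 1 + (ord_p L − ord_p m))`. Private helper (third copy of the seat's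
`valuation_int_mul_bdpShape`, which is private in its file). [folklore] -/
private theorem valuation_int_mul_bdpShape'' (e : ℤ_[p]) (a : ℤ) (L : ℚ_[p]) (m : ℕ)
    (h : (e : ℚ_[p]) * ((1 - (a : ℚ_[p]) * (p : ℚ_[p])⁻¹ + (p : ℚ_[p])⁻¹) * (L / (m : ℚ_[p]))) ^ 2 ≠ 0) :
    ((e : ℚ_[p]) * ((1 - (a : ℚ_[p]) * (p : ℚ_[p])⁻¹ + (p : ℚ_[p])⁻¹) * (L / (m : ℚ_[p]))) ^ 2).valuation =
      ((e : ℚ_[p]).valuation : ℤ) +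
        2 * ((padicValInt p (1 - a + p) : ℤ) - 1 + (L.valuation - (padicValNat p m : ℤ))) := by
  have hp0 : (p : ℚ_[p]) ≠ 0 := by exact_mod_cast hp.out.ne_zero
  have he0 : (e : ℚ_[p]) ≠ 0 := by
    intro h0; apply h; rw [h0]; ring
  have hA0 : (1 - (a : ℚ_[p]) * (p : ℚ_[p])⁻¹ + (p : ℚ_[p])⁻¹) ≠ 0 := by
    intro h0; apply h; rw [h0]; ring
  have hLm0 : L / (m : ℚ_[p]) ≠ 0 := by
    intro h0; apply h; rw [h0]; ring
  have hL0 : L ≠ 0 := by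
    intro h0; apply hLm0; rw [h0, zero_div]
  have hm0 : (m : ℚ_[p]) ≠ 0 := by
    intro h0; apply hLm0; rw [h0, div_zero]
  have hAeq : (1 - (a : ℚ_[p]) * (p : ℚ_[p])⁻¹ + (p : ℚ_[p])⁻¹) =
      ((1 - a + p : ℤ) : ℚ_[p]) * (p : ℚ_[p])⁻¹ := by
    push_cast
    field_simp
    ring
  have hA1 : ((1 - a + p : ℤ) : ℚ_[p]) ≠ 0 := by
    intro h0; apply hA0; rw [hAeq, h0, zero_mul]
  have hvA : (1 - (a : ℚ_[p]) * (p : ℚ_[p])⁻¹ + (p : ℚ_[p])⁻¹).valuation =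
      (padicValInt p (1 - a + p) : ℤ) - 1 := by
    rw [hAeq, Padic.valuation_mul hA1 (inv_ne_zero hp0), Padic.valuation_intCast,
      Padic.valuation_inv, Padic.valuation_p]
    ring
  have hvL : (L / (m : ℚ_[p])).valuation = L.valuation - (padicValNat p m : ℤ) := by
    rw [div_eq_mul_inv, Padic.valuation_mul hL0 (inv_ne_zero hm0), Padic.valuation_inv,
      Padic.valuation_natCast]
    ring
  rw [Padic.valuation_mul he0 (pow_ne_zero 2 (mul_ne_zero hA0 hLm0)), Padic.valuation_pow,
    Padic.valuation_mul hA0 hLm0, hvA, hvL]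
  ring

end Valuation

variable (W : WeierstrassCurve ℚ) [W.IsElliptic] [W.IsGloballyMinimal] (p : ℕ) [Fact p.Prime]
  (K : Type) [Field K] [NumberField K] (P : (W.baseChange K).toAffine.Point)

/-! ### §1 The display in valuations -/

/-- **The (IMC⊇∘BDP𝟙) display in valuations, as a ONE-SIDED bound**: granted the displayed conclusion
of Castella–Wan 2024 Thm. 5.3 ∘ Brooks at the trivial character for the point `P ∈ E(K)` (the second
conjunct of `shimuraCurve_heegnerPoint_grossZagier_bdpLowerBound_goodSS`, or the conclusion of the `N⁻ = 1`
composite), for EVERY generator `𝓖` of `ch_Λ(X_ac)` (strict at `vbar`) with `𝓖(0) ≠ 0`: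
`2·(ord_p(1 − a_p + p) − 1 + ord_p log_{ω_E} P_v) ≤ ord_p 𝓖(0)` (`e ∈ ℤ_p` has `ord_p e ≥ 0`).
[cite: CastellaWan2023, Thm. 5.3 (MS pp. 23–24)] [cite: JetchevSkinnerWan2017, §5.1.2 (arXiv pp. 22–23) and §7.4.2 (p. 30)] -/
theorem le_valuation_constantCoeff_of_bdpDisplay
    (hBDP : ∀ (ι : K →+* ℚ_[p]) (v vbar : HeightOneSpectrum (𝓞 K)),
        (∀ x : 𝓞 K, x ∈ v.asIdeal ↔ ‖ι (x : K)‖ < 1) →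
        ((p : ℕ) : 𝓞 K) ∈ vbar.asIdeal → vbar ≠ v →
      ∀ (κ : ZpExtension K p), κ.IsAnticyclotomic →
      ∀ (γ : Field.absoluteGaloisGroup K) [Fact (κ.IsTopGenerator γ)],
      ∀ F : IwasawaAlgebra p,
        AcSelmer.XAc.charIdeal (W.baseChange K) p κ vbar ∅ γ = Ideal.span {F} →
        ∃ e : ℤ_[p],
          ((PowerSeries.constantCoeff F : ℤ_[p]) : ℚ_[p]) =
            (e : ℚ_[p]) *
              ((1 - (W.frobeniusTrace p : ℚ_[p]) * (p : ℚ_[p])⁻¹ + (p : ℚ_[p])⁻¹) *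
                ((W.baseChange ℚ_[p]).padicLogPoint
                    (formalIndex W p • padicPointOf W p ι P) /
                  (formalIndex W p : ℚ_[p]))) ^ 2)
    (ι : K →+* ℚ_[p]) (v vbar : HeightOneSpectrum (𝓞 K))
    (hv : ∀ x : 𝓞 K, x ∈ v.asIdeal ↔ ‖ι (x : K)‖ < 1)
    (hvbar : ((p : ℕ) : 𝓞 K) ∈ vbar.asIdeal) (hne : vbar ≠ v)
    (κ : ZpExtension K p) (hκ : κ.IsAnticyclotomic)
    (γ : absoluteGaloisGroup K) [Fact (κ.IsTopGenerator γ)]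
    (G : IwasawaAlgebra p) (hG : AcSelmer.XAc.charIdeal (W.baseChange K) p κ vbar ∅ γ = Ideal.span {G})
    (hG0 : PowerSeries.constantCoeff G ≠ 0) :
    2 * ((padicValInt p (1 - W.frobeniusTrace p + p) : ℤ) - 1 +
        Literature.NumberTheory.EllipticCurves.padicLogOrd W p ι P) ≤
      ((PowerSeries.constantCoeff G).valuation : ℤ) := by
  obtain ⟨e, he⟩ := hBDP ι v vbar hv hvbar hne κ hκ γ G hG
  have hrhs : (e : ℚ_[p]) *
      ((1 - (W.frobeniusTrace p : ℚ_[p]) * (p : ℚ_[p])⁻¹ + (p : ℚ_[p])⁻¹) *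
        ((W.baseChange ℚ_[p]).padicLogPoint (formalIndex W p • padicPointOf W p ι P) /
          (formalIndex W p : ℚ_[p]))) ^ 2 ≠ 0 := by
    rw [← he]
    exact PadicInt.coe_ne_zero.2 hG0
  have hval := congrArg Padic.valuation he
  rw [PadicInt.valuation_coe, valuation_int_mul_bdpShape'' e (W.frobeniusTrace p) _ _ hrhs] at hval
  have he0 : (0 : ℤ) ≤ ((e : ℚ_[p]).valuation : ℤ) := PadicInt.valuation_coe_nonneg
  rw [Literature.NumberTheory.EllipticCurves.padicLogOrd]
  omega

/-! ### §2 The on-tree link from the display and Castella 2018 Thm. 2.3 -/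

/-- **(IMC≥∘BDP)ᵍ `X11b.IMCLowerWaldspurgerOnTreeGoodAt p κ 𝔭 γ (embAt K p 𝔭) P` from the (IMC⊇∘BDP𝟙)
DISPLAY at `P` and Castella 2018 Thm. 2.3 (control, `h23`)**: `E/ℚ` semistable, `p ≥ 5` with `ρ̄_{E,p}`
irreducible, `K` imaginary quadratic with `p` split (nothing assumed at the other primes of `N` — a
Jetchev–Skinner–Wan field with `N⁻ ≠ 1` qualifies), `rank E(K) = 1`, `Ш(E/K)[p^∞]` finite, `P` of
infinite order; `κ` anticyclotomic, `γ` a generator, `𝔭 ∋ p` of degree one. The generator `F` of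
`ch_Λ(X_ac)` (strict at `𝔭`, `F(0) ≠ 0`) comes from Thm. 2.3 at THE embedding `embAt 𝔭`; the display is
applied at the OTHER prime `w` (frame `embAt w`, strict prime `𝔭`); the two logarithm valuations agree in
rank one (`embAt w = embAt 𝔭 ∘ σ`). The seat's `…_of_thm53thm32_of_thm23_clauses`, letter for letter, with
the composite replaced by `hBDP`. [cite: CastellaWan2023, Thm. 5.3 (MS pp. 23–24)]
[cite: JetchevSkinnerWan2017, §5.1.2 (arXiv pp. 22–23)] [cite: Castella2018, Thm. 2.3 (p. 5), Def. 2.2] -/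
theorem X11b.imcLowerWaldspurgerOnTreeGoodAt_of_bdpDisplay_of_thm23
    (hBDP : ∀ (ι : K →+* ℚ_[p]) (v vbar : HeightOneSpectrum (𝓞 K)),
        (∀ x : 𝓞 K, x ∈ v.asIdeal ↔ ‖ι (x : K)‖ < 1) →
        ((p : ℕ) : 𝓞 K) ∈ vbar.asIdeal → vbar ≠ v →
      ∀ (κ : ZpExtension K p), κ.IsAnticyclotomic →
      ∀ (γ : Field.absoluteGaloisGroup K) [Fact (κ.IsTopGenerator γ)],
      ∀ F : IwasawaAlgebra p,
        AcSelmer.XAc.charIdeal (W.baseChange K) p κ vbar ∅ γ = Ideal.span {F} →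
        ∃ e : ℤ_[p],
          ((PowerSeries.constantCoeff F : ℤ_[p]) : ℚ_[p]) =
            (e : ℚ_[p]) *
              ((1 - (W.frobeniusTrace p : ℚ_[p]) * (p : ℚ_[p])⁻¹ + (p : ℚ_[p])⁻¹) *
                ((W.baseChange ℚ_[p]).padicLogPoint
                    (formalIndex W p • padicPointOf W p ι P) /
                  (formalIndex W p : ℚ_[p]))) ^ 2)
    (h23 : thm23_anticyclotomicControl)
    (hp : 5 ≤ p) (hsst : Semistable W) (hirr : Irr W p) (hK : IsImaginaryQuadratic K)
    (hHp : SatisfiesHeegnerHypothesis p K)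
    (κ : ZpExtension K p) (hκ : κ.IsAnticyclotomic)
    (γ : absoluteGaloisGroup K) [Fact (κ.IsTopGenerator γ)]
    (𝔭 : HeightOneSpectrum (𝓞 K)) (h𝔭 : ((p : ℕ) : 𝓞 K) ∈ 𝔭.asIdeal)
    (he : 𝔭.asIdeal.ramificationIdx (𝓞 ℚ) = 1) (hf : 𝔭.asIdeal.inertiaDeg (𝓞 ℚ) = 1)
    (hrk : (W.baseChange K).mordellWeilRank = 1)
    (hfin : Finite (AddCommGroup.primaryComponent (W.baseChange K).sha p))
    (hPinf : ¬ IsOfFinAddOrder P) :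
    X11b.IMCLowerWaldspurgerOnTreeGoodAt p κ 𝔭 γ (X11b.embAt K p 𝔭 h𝔭 he hf) P := by
  -- the other prime `w` above `p`, of degree one, and THE embedding at it
  obtain ⟨w, hw, hwne⟩ := X11b.exists_other_prime hHp 𝔭 h𝔭
  have hsplit : X11b.SplitsIn K p := hHp p Fact.out (dvd_refl p)
  obtain ⟨hew, hfw⟩ := X11b.degreeOne_of_splitsIn hK.1 hsplit hw
  set ιw : K →+* ℚ_[p] := X11b.embAt K p w hw hew hfw with hιw
  set ι𝔭 : K →+* ℚ_[p] := X11b.embAt K p 𝔭 h𝔭 he hf with hι𝔭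
  -- the generator with non-zero constant term of the module strict at `𝔭`, from Castella Thm. 2.3
  obtain ⟨htors, F, hF, hF0, -⟩ := h23 W p hsst hp hirr K hK hHp ι𝔭 𝔭
    (X11b.mem_asIdeal_iff_norm_embAt_lt_one 𝔭 h𝔭 he hf) κ hκ γ hrk hfin P hPinf
  -- the display at the frame `(ιw, w)`, strict prime `𝔭`
  have hval := le_valuation_constantCoeff_of_bdpDisplay W p K P hBDP ιw w 𝔭
    (X11b.mem_asIdeal_iff_norm_embAt_lt_one w hw hew hfw) h𝔭 (fun h ↦ hwne h.symm) κ hκ γ F hF hF0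
  -- `ιw = ι𝔭 ∘ σ` for an involution `σ`; the log valuations agree in rank one
  obtain ⟨σ, hσ, hισ⟩ := X11b.exists_involutive_comp_eq hK.1 ι𝔭 ιw
  have hlog : Literature.NumberTheory.EllipticCurves.padicLogOrd W p ιw P = X11b.padicLogOrd W p ι𝔭 P := by
    rw [← hισ, ← X11b.padicLogOrd_eq_literature]
    exact Rank1Residual.padicLogOrd_comp_eq_of_rank_one W p (by omega) σ hσ ι𝔭 hrk P hPinf
  refine ⟨(PowerSeries.constantCoeff F).valuation,
    (X11b.AcSelmer.hasCharValuationAt_iff_literature _ p κ 𝔭 ∅ γ _).mpr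
      (AcSelmer.XAc.hasCharValuationAt_of_eq htors hF hF0 rfl), ?_⟩
  rw [hlog] at hval
  omega

end Summit.BirchSwinnertonDyer.BirchSwinnertonDyer.Theorems.AnticyclotomicRankZero

end
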